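import Literature.Probability.RandomPlanarGeometry.CritPercSLESimplePath
import Literature.Probability.RandomPlanarGeometry.SLEOnePointSwallowingProofs
import Literature.Probability.RandomPlanarGeometry.SLEOnePointMartingaleProofs
import HarnessLib

/-!
# Real points near the driving point are swallowed quickly (SLE_κ, `κ > 4`)

Topic `Probability/RandomPlanarGeometry`; theorems and two small path-space definitions. For
`κ > 4` every positive real point `x` is a.s. swallowed by chordal SLE_κ (`T_x < ∞`; Lawler
(2005), Prop. 6.8 / Rohde–Schramm (2005), Lemma 6.5, PROVED in the tree:
`sle_swallowingTime_lt_top_of_onePointMartingales` with the discharged Itô steps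
`sle_martingale_onePointPow_holds`, `sle_martingale_onePointSq_holds`). By **Brownian scaling**
(`identDistrib_sleDriving_scale_holds`; deterministic part `Loewner.swallowingTime_scale`:
`T_{cx}[cW(·/c²)] = c² T_x[W]`) the law of `T_c` is that of `c² T_1`, so `T_c → 0` in probability
as `c ↓ 0`; as `T_x` is non-decreasing in `x` (`Loewner.swallowingTime_mono_right`), **almost
surely, for every `t > 0` some point `1/(n+1)` is swallowed by time `t`**
(`ae_forall_exists_swallowingTime_le`). This is the probabilistic input "the SLE_κ path touches the
boundary immediately to the right of its starting point" of the a.s. non-simplicity of the trace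
for `κ > 4` (Rohde–Schramm (2005), §1; Schramm (2000)).

The equality in law is transported to swallowing-time events as in `CritPercSLESimplePath.lean`:
the event `{T_x ≤ t}` is read on the path space through the measurable regularisation
`Literature.Probability.Process.pathRegularize` (`regPath`, `swallowLeEvent`,
`measure_swallowingTime_le_eq_of_identDistrib`), where it is measurable by
`Loewner.measurableSet_lt_swallowingTime`.

## References

* G. F. Lawler, *Conformally Invariant Processes in the Plane* (2005), Prop. 6.5 (scaling),
  Prop. 6.8.
* S. Rohde, O. Schramm, *Basic properties of SLE*, Ann. of Math. 161 (2005), Prop. 2.1 (i),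
  Lemma 6.5.
-/

noncomputable section

open Set Filter MeasureTheory ProbabilityTheory Complex
open _root_.Topology
open scoped NNReal ENNReal

namespace Literature.Probability.RandomPlanarGeometry

open Loewner

/-! ### Swallowing-time events on the path space -/

/-- The regularised path recentred at time `0` (`pathRegularize w - pathRegularize w 0`): a
measurable functional of the path, continuous in time, starting at `0`, and equal to `w` when `w`
is continuous with `w 0 = 0`. [folklore] -/
def regPath (w : ℝ≥0 → ℝ) (u : ℝ≥0) : ℝ :=
  Process.pathRegularize w u - Process.pathRegularize w 0

/-- `regPath w` is continuous. [folklore] -/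
theorem continuous_regPath (w : ℝ≥0 → ℝ) : Continuous (regPath w) :=
  (Process.continuous_pathRegularize w).sub continuous_const

/-- `regPath w 0 = 0`. [folklore] -/
theorem regPath_zero (w : ℝ≥0 → ℝ) : regPath w 0 = 0 := sub_self _

/-- Each coordinate of `regPath` is measurable on the path space. [folklore] -/
theorem measurable_regPath (u : ℝ≥0) : Measurable fun w ↦ regPath w u :=
  (Process.measurable_pathRegularize u).sub (Process.measurable_pathRegularize 0)

/-- For a continuous path from `0`, `regPath w = w`. [folklore] -/
theorem regPath_eq_self {w : ℝ≥0 → ℝ} (hw : Continuous w) (hw0 : w 0 = 0) : regPath w = w := by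
  ext u
  simp [regPath, Process.pathRegularize_eq_self_of_continuous hw, hw0]

/-- The path-space event **`{T_x ≤ t}`** (read through `regPath`). [folklore] -/
def swallowLeEvent (x : ℝ) (t : ℝ≥0) : Set (ℝ≥0 → ℝ) :=
  {w | ¬ (t : WithTop ℝ≥0) < swallowingTime (regPath w) x}

/-- The event `{T_x ≤ t}` is measurable on the path space (`x > 0`). [folklore] -/
theorem measurableSet_swallowLeEvent {x : ℝ} (hx : 0 < x) (t : ℝ≥0) :
    MeasurableSet (swallowLeEvent x t) :=
  (measurableSet_lt_swallowingTime (W := regPath) (t := t) continuous_regPath regPath_zero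
    (fun u _ ↦ measurable_regPath u) hx).compl

/-- For a continuous path from `0`, membership in `swallowLeEvent x t` is `T_x ≤ t`. [folklore] -/
theorem mem_swallowLeEvent_iff {w : ℝ≥0 → ℝ} (hw : Continuous w) (hw0 : w 0 = 0) (x : ℝ) (t : ℝ≥0) :
    w ∈ swallowLeEvent x t ↔ swallowingTime w x ≤ t := by
  rw [swallowLeEvent, mem_setOf_eq, regPath_eq_self hw hw0, not_lt]

/-- **Law transfer for `{T_x ≤ t}`**: for two families of continuous paths from `0` which are
identically distributed on the path space, the events `{T_x ≤ t}` have the same probability.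
[folklore] -/
theorem measure_swallowingTime_le_eq_of_identDistrib {Ω : Type*} [MeasurableSpace Ω]
    {P : Measure Ω} {W₁ W₂ : Ω → ℝ≥0 → ℝ} (hc₁ : ∀ ω, Continuous (W₁ ω))
    (hc₂ : ∀ ω, Continuous (W₂ ω)) (h0₁ : ∀ ω, W₁ ω 0 = 0) (h0₂ : ∀ ω, W₂ ω 0 = 0)
    (hid : IdentDistrib W₁ W₂ P P) {x : ℝ} (hx : 0 < x) (t : ℝ≥0) :
    P {ω | swallowingTime (W₁ ω) x ≤ t} = P {ω | swallowingTime (W₂ ω) x ≤ t} := by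
  have h1 : {ω | swallowingTime (W₁ ω) x ≤ t} = W₁ ⁻¹' swallowLeEvent x t := by
    ext ω; exact (mem_swallowLeEvent_iff (hc₁ ω) (h0₁ ω) x t).symm
  have h2 : {ω | swallowingTime (W₂ ω) x ≤ t} = W₂ ⁻¹' swallowLeEvent x t := by
    ext ω; exact (mem_swallowLeEvent_iff (hc₂ ω) (h0₂ ω) x t).symm
  rw [h1, h2]
  exact hid.measure_mem_eq (measurableSet_swallowLeEvent hx t)

/-! ### Scaling of swallowing times in law -/

variable {κ : ℝ≥0}

/-- The rescaled driving path `u ↦ c W(u/c²)` (`c ≠ 0`). [folklore] -/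
theorem continuous_sleDriving_rescale (κ : ℝ≥0) (c : ℝ≥0) (ω : ℝ≥0 → ℝ) :
    Continuous fun u : ℝ≥0 ↦ (c : ℝ) * sleDriving κ ω (u / c ^ 2) :=
  continuous_const.mul ((continuous_sleDriving κ ω).comp (continuous_id.div_const _))

/-- **Brownian scaling of the driving function**, in the form `W ∼ c W(·/c²)` (`c ≠ 0`;
`identDistrib_sleDriving_scale_holds` with parameter `c⁻¹`). [cite: RohdeSchramm2005, Prop. 2.1] -/
theorem identDistrib_sleDriving_rescale (κ : ℝ≥0) {c : ℝ≥0} (hc : c ≠ 0) :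
    IdentDistrib (fun ω u ↦ sleDriving κ ω u) (fun ω u ↦ (c : ℝ) * sleDriving κ ω (u / c ^ 2))
      Process.preWienerMeasure Process.preWienerMeasure := by
  have h := identDistrib_sleDriving_scale_holds κ (inv_ne_zero hc)
  have heq : (fun (ω : ℝ≥0 → ℝ) (t : ℝ≥0) ↦ ((c⁻¹ : ℝ≥0) : ℝ)⁻¹ * sleDriving κ ω (c⁻¹ ^ 2 * t)) =
      fun ω u ↦ (c : ℝ) * sleDriving κ ω (u / c ^ 2) := by
    funext ω u
    rw [NNReal.coe_inv, inv_inv, inv_pow, div_eq_inv_mul]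
  rw [heq] at h
  exact h

/-- **Scaling of the law of `T_c`**: `P[T_c ≤ t] = P[T_1 ≤ t/c²]` for `c > 0`
(equality in law `W ∼ cW(·/c²)` and `T_c[cW(·/c²)] = c² T_1[W]`, `Loewner.swallowingTime_scale`).
[cite: Lawler2005, Prop. 6.5] -/
theorem measure_swallowingTime_le_eq (κ : ℝ≥0) {c : ℝ≥0} (hc : c ≠ 0) (t : ℝ≥0) :
    Process.preWienerMeasure {ω | swallowingTime (sleDriving κ ω) c ≤ t} =
      Process.preWienerMeasure {ω | swallowingTime (sleDriving κ ω) (1 : ℝ) ≤ (t / c ^ 2 : ℝ≥0)} := by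
  have hc' : (0 : ℝ) < c := by exact_mod_cast pos_iff_ne_zero.2 hc
  have h := measure_swallowingTime_le_eq_of_identDistrib (P := Process.preWienerMeasure)
    (fun ω ↦ continuous_sleDriving κ ω) (continuous_sleDriving_rescale κ c)
    (fun ω ↦ sleDriving_zero κ ω) (fun ω ↦ by simp [sleDriving_zero]) (identDistrib_sleDriving_rescale κ hc)
    hc' t
  rw [h]
  congr 1
  ext ω
  simp only [mem_setOf_eq]
  have hsc := swallowingTime_scale hc (sleDriving κ ω) (1 : ℂ)
  rw [mul_one] at hsc
  have hcoe : ((c : ℝ) : ℂ) = ((c : ℝ≥0) : ℂ) := rfl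
  rw [show ((c : ℝ) : ℂ) = (c : ℂ) from rfl] at *
  rw [show (fun u : ℝ≥0 ↦ (c : ℝ) * sleDriving κ ω (u / c ^ 2)) = fun s ↦ (c : ℝ) * sleDriving κ ω (s / c ^ 2)
    from rfl, show ((c : ℝ) : ℂ) = ((c : ℝ≥0) : ℝ) from rfl]
  rw [show (((c : ℝ≥0) : ℝ) : ℂ) = ((c : ℝ≥0) : ℂ) from rfl] at hsc ⊢
  rw [hsc, show ((1 : ℝ) : ℂ) = (1 : ℂ) from rfl]
  -- `c² · T ≤ t ↔ T ≤ t / c²` in `WithTop ℝ≥0`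
  have hc2 : (c ^ 2 : ℝ≥0) ≠ 0 := pow_ne_zero 2 hc
  induction swallowingTime (sleDriving κ ω) (1 : ℂ) with
  | top =>
    rw [WithTop.mul_top (by exact_mod_cast hc2)]
    simp only [top_le_iff, WithTop.coe_ne_top]
  | coe T =>
    rw [← WithTop.coe_mul, WithTop.coe_le_coe, WithTop.coe_le_coe, le_div_iff₀ (pos_iff_ne_zero.2 hc2),
      mul_comm]

/-! ### Almost surely, small points are swallowed quickly -/

/-- `{T_x ≤ t}` is an event (`x ≠ 0`). [folklore] -/
theorem measurableSet_sle_swallowingTime_le (κ : ℝ≥0) {x : ℝ} (hx : x ≠ 0) (t : ℝ≥0) :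
    MeasurableSet {ω | swallowingTime (sleDriving κ ω) x ≤ t} := by
  have h := (measurableSet_lt_swallowingTime_sle κ hx t).compl
  have heq : {ω : ℝ≥0 → ℝ | swallowingTime (sleDriving κ ω) x ≤ t} =
      {ω | (t : WithTop ℝ≥0) < swallowingTime (sleDriving κ ω) x}ᶜ := by
    ext ω; simp [not_lt]
  rw [heq]
  exact brownianFiltration.le t _ h

/-- **`P[T_1 ≤ s] → 1` as `s → ∞`** for `κ > 4` (a.s. `T_1 < ∞`, continuity of the measure along
the increasing events `{T_1 ≤ n}`). [cite: Lawler2005, Prop. 6.8] -/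
theorem tendsto_measure_swallowingTime_one_le (hκ : 4 < κ) :
    Tendsto (fun n : ℕ ↦ Process.preWienerMeasure
      {ω | swallowingTime (sleDriving κ ω) (1 : ℝ) ≤ ((n : ℝ≥0) : WithTop ℝ≥0)}) atTop (𝓝 1) := by
  haveI := isProbabilityMeasure_preWienerMeasure'
  have hae := sle_swallowingTime_lt_top_of_onePointMartingales sle_martingale_onePointPow_holds
    sle_martingale_onePointSq_holds hκ one_pos
  have hmono : Monotone fun n : ℕ ↦ {ω : ℝ≥0 → ℝ |
      swallowingTime (sleDriving κ ω) (1 : ℝ) ≤ ((n : ℝ≥0) : WithTop ℝ≥0)} := by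
    intro m n hmn ω hω
    simp only [mem_setOf_eq] at hω ⊢
    exact hω.trans (by exact_mod_cast hmn)
  have hlim := tendsto_measure_iUnion_atTop (μ := Process.preWienerMeasure) hmono
  have hA : ∀ n : ℕ, MeasurableSet {ω : ℝ≥0 → ℝ |
      swallowingTime (sleDriving κ ω) (1 : ℝ) ≤ ((n : ℝ≥0) : WithTop ℝ≥0)} := fun n ↦
    measurableSet_sle_swallowingTime_le κ one_ne_zero n
  have hae' : ∀ᵐ ω ∂Process.preWienerMeasure, ω ∈ ⋃ n : ℕ, {ω : ℝ≥0 → ℝ |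
      swallowingTime (sleDriving κ ω) (1 : ℝ) ≤ ((n : ℝ≥0) : WithTop ℝ≥0)} := by
    filter_upwards [hae] with ω hω
    obtain ⟨T, hT⟩ := WithTop.ne_top_iff_exists.1 hω.ne
    obtain ⟨n, hn⟩ := exists_nat_ge T
    refine mem_iUnion.2 ⟨n, ?_⟩
    simp only [mem_setOf_eq, ← hT]
    exact_mod_cast hn
  have hU : Process.preWienerMeasure (⋃ n : ℕ, {ω : ℝ≥0 → ℝ |
      swallowingTime (sleDriving κ ω) (1 : ℝ) ≤ ((n : ℝ≥0) : WithTop ℝ≥0)}) = 1 := by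
    rw [← prob_compl_eq_zero_iff (MeasurableSet.iUnion hA)]
    exact ae_iff.1 hae'
  rw [hU] at hlim
  exact hlim

/-- **Almost surely, for `κ > 4`, every time horizon `t > 0` sees some point `1/(n+1)` swallowed**:
`P[∃ n, T_{1/(n+1)} ≤ t] = 1`. Indeed `P[T_{1/(n+1)} ≤ t] = P[T_1 ≤ t (n+1)²] → 1`.
[cite: RohdeSchramm2005, Lemma 6.5] -/
theorem ae_exists_swallowingTime_le (hκ : 4 < κ) {t : ℝ≥0} (ht : 0 < t) :
    ∀ᵐ ω ∂Process.preWienerMeasure, ∃ n : ℕ,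
      swallowingTime (sleDriving κ ω) (((1 : ℝ) / ((n : ℝ) + 1) : ℝ) : ℂ) ≤ t := by
  haveI := isProbabilityMeasure_preWienerMeasure'
  set xn : ℕ → ℝ := fun n ↦ (1 : ℝ) / ((n : ℝ) + 1) with hxn
  have hxn0 : ∀ n, 0 < xn n := fun n ↦ by rw [hxn]; positivity
  rw [ae_iff]
  simp only [not_exists, not_le]
  -- the complement is contained in each `{T_{xₙ} ≤ t}ᶜ`, whose measure tends to `0`
  set cn : ℕ → ℝ≥0 := fun n ↦ 1 / ((n : ℝ≥0) + 1) with hcn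
  have hcn0 : ∀ n, cn n ≠ 0 := fun n ↦ by rw [hcn]; positivity
  have hcoe : ∀ n, ((cn n : ℝ≥0) : ℝ) = xn n := fun n ↦ by rw [hcn, hxn]; push_cast; ring
  have hle : ∀ n, Process.preWienerMeasure {ω | ∀ n : ℕ,
      (t : WithTop ℝ≥0) < swallowingTime (sleDriving κ ω) (xn n)} ≤
      1 - Process.preWienerMeasure {ω | swallowingTime (sleDriving κ ω) (1 : ℝ) ≤
        ((t / cn n ^ 2 : ℝ≥0) : WithTop ℝ≥0)} := by
    intro n
    rw [← measure_swallowingTime_le_eq κ (hcn0 n) t, hcoe n]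
    have hms := measurableSet_sle_swallowingTime_le κ (x := xn n) (hxn0 n).ne' t
    rw [← prob_compl_eq_one_sub hms]
    refine measure_mono fun ω hω h ↦ ?_
    have h' : swallowingTime (sleDriving κ ω) (xn n) ≤ t := h
    exact absurd h' (not_le.2 (hω n))
  -- `P[T_1 ≤ t (n+1)²] → 1`
  have hlim : Tendsto (fun n : ℕ ↦ Process.preWienerMeasure {ω | swallowingTime (sleDriving κ ω) (1 : ℝ) ≤
      ((t / cn n ^ 2 : ℝ≥0) : WithTop ℝ≥0)}) atTop (𝓝 1) := by
    have h1 := tendsto_measure_swallowingTime_one_le hκ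
    have hdiv : ∀ n : ℕ, t / cn n ^ 2 = t * ((n : ℝ≥0) + 1) ^ 2 := fun n ↦ by
      rw [hcn]; field_simp
    -- the horizons `⌊t (n+1)²⌋₊ → ∞`
    have hf : Tendsto (fun n : ℕ ↦ ⌊(t : ℝ) * ((n : ℝ) + 1) ^ 2⌋₊) atTop atTop := by
      refine tendsto_nat_floor_atTop.comp ?_
      refine Tendsto.const_mul_atTop (by exact_mod_cast ht) ?_
      refine (tendsto_pow_atTop two_ne_zero).comp ?_
      exact tendsto_atTop_add_const_right _ 1 tendsto_natCast_atTop_atTop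
    refine tendsto_of_tendsto_of_tendsto_of_le_of_le (h1.comp hf) tendsto_const_nhds (fun n ↦ ?_)
      (fun n ↦ prob_le_one)
    · simp only [Function.comp_apply]
      refine measure_mono fun ω hω ↦ ?_
      simp only [mem_setOf_eq] at hω ⊢
      refine hω.trans ?_
      rw [hdiv]
      have h2 : ((⌊(t : ℝ) * ((n : ℝ) + 1) ^ 2⌋₊ : ℝ≥0) : ℝ) ≤ ((t * ((n : ℝ≥0) + 1) ^ 2 : ℝ≥0) : ℝ) := by
        push_cast
        exact Nat.floor_le (by positivity)
      exact_mod_cast h2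
  have hlim' : Tendsto (fun n : ℕ ↦ 1 - Process.preWienerMeasure {ω | swallowingTime (sleDriving κ ω) (1 : ℝ) ≤
      ((t / cn n ^ 2 : ℝ≥0) : WithTop ℝ≥0)}) atTop (𝓝 0) := by
    have := ENNReal.Tendsto.sub tendsto_const_nhds hlim (Or.inl ENNReal.one_ne_top)
    rwa [tsub_self] at this
  exact le_antisymm (ge_of_tendsto' hlim' hle) bot_le

/-- **Almost surely, for `κ > 4`: for every `m` there is `n` with `T_{1/(n+1)} ≤ 1/(m+1)`** —
`inf_{x > 0} T_x = 0` in countable form. [cite: RohdeSchramm2005, Lemma 6.5] -/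
theorem ae_forall_exists_swallowingTime_le (hκ : 4 < κ) :
    ∀ᵐ ω ∂Process.preWienerMeasure, ∀ m : ℕ, ∃ n : ℕ,
      swallowingTime (sleDriving κ ω) (((1 : ℝ) / ((n : ℝ) + 1) : ℝ) : ℂ) ≤
        ((1 / ((m : ℝ≥0) + 1) : ℝ≥0) : WithTop ℝ≥0) :=
  ae_all_iff.2 fun m ↦ ae_exists_swallowingTime_le hκ (by positivity)

end Literature.Probability.RandomPlanarGeometry
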